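import Literature.Computability.Complexity.FPRAS
import Literature.Computability.Complexity.OracleSimulateFP
import Literature.Computability.Complexity.HashBricks
import Literature.Computability.Complexity.UniformProbBlocks
import HarnessLib

/-!
# An AP-reduction pulls an FPRAS back: `N ≤_AP N'` and an FPRAS for `N'` give an FPRAS for `N`

Sequel of `FPRAS.lean` (Dyer–Goldberg–Greenhill–Jerrum, *The relative complexity of approximate
counting problems*, Algorithmica 38 (2003) 471–500, §1): the defining use of an
approximation-preserving reduction — "if an approximation-preserving reduction from `f` to `g`
exists [...] and `g` has an FPRAS then so does `f`" — for the tree's transcript-model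
`APReducible` and confidence-parameter `HasFPRAS` (`FPRAS.lean`, module docstring, "Relation to the
printed definition", direction (a)).

* `HasFPRAS.of_apReducible : APReducible N N' → HasFPRAS N' → HasFPRAS N`;
* `HasFPRAS.comp_countPreserving` — the one-exact-query special case proved directly as an `FP`
  composition: for `g ∈ FP` with `N x = N' (g x)` (a parsimonious reduction), `HasFPRAS N' → HasFPRAS N`
  (run the transducer on `g x`, same accuracy/confidence, a prefix of the coins); `HasFPRAS.comp`.

Proof (Aaronson–Arkhipov 2013, proof of Thm. 1.1, p. 178: "a deterministic algorithm that takes a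
random string as part of its input", fresh coins for each of the polynomially many oracle calls and a
union bound; Arora–Barak 2009 §7.4.1). Given the reduction `M` (round/query budget `q`, coins `c_M`)
and the FPRAS transducer `F ∈ FP` (coins `c_F`) for `N'`, the FPRAS for `N` is the `FP` function
`F⋆ = OracleAlg.simFn (M.mapQuery d₁) pre ans …` (`OracleSimulateFP.lean`): on
`⟨x, 1⁰, 1^{kη}, 1^{kδ}, U⟩` it runs `M` on `w = ⟨x, 1⁰, 1^{kη}, 1^{2kδ}, u⟩` (confidence doubled, `u` cut
out of `U`), the query map `d₁` (`OracleQueryMap.lean`) stamps each query with its round index `i`,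
and the answer function `ans ∈ FP` answers the canonical counting query `⟨y, 1⁰, 1ᵏ, 1¹, ε⟩` of round
`i` by `F ⟨y, 1⁰, 1ᵏ, 1ᴷ, vᵢ⟩` with the `i`-th coin block `vᵢ` of `U` and confidence `K ≥ 2kδ·(#rounds)`.
Coin strings are bad with probability `≤ 1/(2kδ)` (the reduction's own clause (ii) at confidence
`2kδ`, `uniformProb_block_le'`) plus `≤ #rounds / K ≤ 1/(2kδ)` (some oracle answer out of tolerance:
`uniformProb_exists_badBlock_le'`, each block fresh given the coins outside it). On a good coin string
the history-dependent rule "the simulated answer along the actual run, the exact count elsewhere" is an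
approximate counter for `N'` (`IsApproxCountRule`), so clause (ii) applies to it, and by locality of
rule-runs (`OracleAlg.runRule_congr`, `RunRule.lean`) the simulated run is that run.

All proved; no named fact. The string functions are assembled from the brick algebra
(`BrickAlgebra.lean`, `PlumbingBricks.lean`, `HashBricks.umulFn`); no machine is written.

## References

* M. Dyer, L. A. Goldberg, C. Greenhill, M. Jerrum, Algorithmica 38 (2003) 471–500, §1
  [DyerEtAl2003].
* S. Aaronson, A. Arkhipov, *The computational complexity of linear optics*, Theory of Computing 9
  (2013), Thm. 1.1 and its proof (p. 178) [AaronsonArkhipovToC2013].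
* S. Arora, B. Barak, *Computational Complexity: A Modern Approach*, CUP 2009, §7.4.1 (error
  reduction, union bound), §3.4 (oracle machines) [AroraBarak2009].
-/

noncomputable section

open scoped Classical

namespace Literature.Computability.Complexity

open _root_.Computability Polynomial Brick Plumb OracleCompose HashBricks

namespace APTransfer

/-! ### Generic lemmas on rule-runs, rewritten queries and coin strings -/

section Generic

variable {β : Type}

/-- **A run with rewritten queries is a rule-run**: `M.mapQuery d` against the oracle `O` runs as
`M` under the history-dependent rule `(E, z) ↦ O (d ⟨x, ⟨listBool E, z⟩⟩)`. [folklore] -/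
theorem runAux_mapQuery_eq_runRule (M : OracleAlg β) (d : List Bool → List Bool) (O : Oracle)
    (x : List Bool) : ∀ (n : ℕ) (E : List (List Bool)),
      (M.mapQuery d).runAux O x n E =
        M.runRule x (fun E z => O (d (boolPair x (boolPair ((encodingList Bool).listBool.encode E) z)))) n E
  | 0, _ => rfl
  | n + 1, E => by
    rw [OracleAlg.runAux_succ, OracleAlg.runRule_succ, OracleAlg.mapQuery_step]
    cases hs : M.step x E with
    | inr b => rfl
    | inl z =>
      dsimp only
      exact runAux_mapQuery_eq_runRule M d O x n _

/-- The same from the empty transcript. [folklore] -/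
theorem run_mapQuery_eq_runRule (M : OracleAlg β) (d : List Bool → List Bool) (O : Oracle)
    (x : List Bool) (n : ℕ) :
    (M.mapQuery d).run O n x =
      M.runRule x (fun E z => O (d (boolPair x (boolPair ((encodingList Bool).listBool.encode E) z)))) n [] :=
  runAux_mapQuery_eq_runRule M d O x n []

/-- **The queries of `M.mapQuery d` are rewritten queries of `M`** at transcripts reachable within
the fuel: each is `d ⟨x, ⟨listBool E', z⟩⟩` with `M.step x E' = inl z` and `|E'| < |E| + n`. [folklore] -/
theorem mem_queriesAux_mapQuery (M : OracleAlg β) (d : List Bool → List Bool) (O : Oracle)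
    (x : List Bool) : ∀ (n : ℕ) (E : List (List Bool)) (z' : List Bool),
      z' ∈ (M.mapQuery d).queriesAux O x n E →
        ∃ (E' : List (List Bool)) (z : List Bool), M.step x E' = Sum.inl z ∧ E'.length < E.length + n ∧
          z' = d (boolPair x (boolPair ((encodingList Bool).listBool.encode E') z))
  | 0, _, _, h => by simp at h
  | n + 1, E, z', h => by
    unfold OracleAlg.queriesAux at h
    rw [OracleAlg.mapQuery_step] at h
    cases hs : M.step x E with
    | inr b => rw [hs] at h; simp at h
    | inl z =>
      rw [hs] at h
      dsimp only at h
      rcases List.mem_cons.1 h with rfl | h'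
      · exact ⟨E, z, hs, by omega, rfl⟩
      · obtain ⟨E', z₀, hE', hlen, rfl⟩ := mem_queriesAux_mapQuery M d O x n _ z' h'
        refine ⟨E', z₀, hE', ?_, rfl⟩
        rw [List.length_append, List.length_singleton] at hlen
        omega

/-- The same for `queries` (from the empty transcript; stated separately so that uses need not unfold
`OracleAlg.queries` against a large round budget). [folklore] -/
theorem mem_queries_mapQuery (M : OracleAlg β) (d : List Bool → List Bool) (O : Oracle) (x : List Bool)
    (n : ℕ) (z' : List Bool) (h : z' ∈ (M.mapQuery d).queries O n x) :
    ∃ (E' : List (List Bool)) (z : List Bool), M.step x E' = Sum.inl z ∧ E'.length < n ∧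
      z' = d (boolPair x (boolPair ((encodingList Bool).listBool.encode E') z)) := by
  have h' : z' ∈ (M.mapQuery d).queriesAux O x n [] := h
  obtain ⟨E', z, h1, h2, h3⟩ := mem_queriesAux_mapQuery M d O x n [] z' h'
  exact ⟨E', z, h1, by simpa using h2, h3⟩

/-- **A query round has a full transcript**: if the step at the transcript of round `j` is a query
then all earlier rounds were queries, so that transcript has exactly `j` answers. [folklore] -/
theorem length_traceR_of_step_inl (M : OracleAlg β) (x : List Bool) (ans : OracleAlg.Rule) :
    ∀ (j : ℕ) {z : List Bool}, M.step x (OracleAlg.traceR M x ans j) = Sum.inl z →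
      (OracleAlg.traceR M x ans j).length = j
  | 0, _, _ => rfl
  | j + 1, z, h => by
    rw [OracleAlg.traceR_succ] at h ⊢
    cases hs : M.step x (OracleAlg.traceR M x ans j) with
    | inl u =>
      rw [OracleAlg.nextR_of_inl M x ans hs, List.length_append, List.length_singleton,
        length_traceR_of_step_inl M x ans j hs]
    | inr b =>
      rw [OracleAlg.nextR_of_inr M x ans hs, hs] at h
      cases h

/-- Monotonicity of `uniformProb m` along an inclusion of the strings of length `m`. [folklore] -/
theorem uniformProb_mono_len {m : ℕ} {E E' : Set (List Bool)}
    (h : ∀ r : List Bool, r.length = m → r ∈ E → r ∈ E') : uniformProb m E ≤ uniformProb m E' := by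
  unfold uniformProb
  refine div_le_div_of_nonneg_right ?_ (by positivity)
  exact_mod_cast Finset.card_le_card fun r hr => by
    simp only [Finset.mem_filter, Finset.mem_univ, true_and] at hr ⊢
    exact h _ r.toList_length hr

/-- **Prefix events**: the prefix of length `ℓ' ≤ ℓ` of a uniform string of length `ℓ` is uniform.
[cite: AroraBarak2009, §7.4.1] -/
theorem uniformProb_take_le_of_le {ℓ' ℓ : ℕ} (hℓ : ℓ' ≤ ℓ) (E : Set (List Bool)) {δ : ℝ}
    (hδ : uniformProb ℓ' E ≤ δ) : uniformProb ℓ {r | r.take ℓ' ∈ E} ≤ δ := by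
  obtain ⟨d, rfl⟩ := Nat.exists_eq_add_of_le hℓ
  have h := uniformProb_block_le (a := 0) (ℓ := ℓ') (d := d) (fun _ => E) fun _ _ => hδ
  rw [Nat.zero_add] at h
  simpa only [List.drop_zero, List.take_zero] using h

end Generic

/-! ### Small list and numeral lemmas -/

section Lists

/-- `|1ⁿ| = n`. [folklore] -/
@[simp] theorem length_unary (n : ℕ) : (unaryEncodeNat n).length = n := by
  rw [unaryEncodeNat_eq_replicate, List.length_replicate]

/-- `1⁰ = ε`. [folklore] -/
@[simp] theorem unary_zero : unaryEncodeNat 0 = [] := rfl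

/-- `1ᵃ 1ᵇ = 1^{a+b}`. [folklore] -/
theorem unary_append (a b : ℕ) : unaryEncodeNat a ++ unaryEncodeNat b = unaryEncodeNat (a + b) := by
  simp only [unaryEncodeNat_eq_replicate, List.replicate_add]

/-- `ones n = 1ⁿ`. [folklore] -/
theorem ones_eq_unary (n : ℕ) : ones n = unaryEncodeNat n := by
  rw [unaryEncodeNat_eq_replicate]

/-- Canonical counting queries determine instance and accuracy (`boolPair_inj`,
`unaryEncodeNat_injective` of `Cryptography/QuantumCircuit.lean`, in the import cone). [folklore] -/
theorem countQuery_canonical_inj {y y' : List Bool} {k k' : ℕ}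
    (h : countQuery y 0 k 1 [] = countQuery y' 0 k' 1 []) : y = y' ∧ k = k' := by
  unfold countQuery at h
  obtain ⟨h1, -⟩ := Cryptography.QCircuit.boolPair_inj h
  obtain ⟨hy, h2⟩ := Cryptography.QCircuit.boolPair_inj h1
  obtain ⟨-, h3⟩ := Cryptography.QCircuit.boolPair_inj h2
  obtain ⟨hk, -⟩ := Cryptography.QCircuit.boolPair_inj h3
  exact ⟨hy, Cryptography.QCircuit.unaryEncodeNat_injective hk⟩

/-- The block `i` of length `ℓ` of a coin string. [folklore] -/
def blk (ℓ i : ℕ) (U : List Bool) : List Bool := (U.drop (i * ℓ)).take ℓ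

/-- Reassembling a string from the coins before, in and after a block. [folklore] -/
theorem take_append_blk_append_drop (a ℓ : ℕ) (r : List Bool) :
    r.take a ++ (r.drop a).take ℓ ++ r.drop (a + ℓ) = r := by
  rw [List.append_assoc, ← List.drop_drop, List.take_append_drop, List.take_append_drop]

/-- The block in the middle. [folklore] -/
theorem blk_mid {ℓ i : ℕ} {pre v post : List Bool} (hpre : pre.length = i * ℓ) (hv : v.length = ℓ) :
    blk ℓ i (pre ++ v ++ post) = v := by
  unfold blk
  rw [List.append_assoc, List.drop_left' hpre, List.take_left' hv]

/-- Dropping past a prefix. [folklore] -/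
theorem drop_append_of_length_le' : ∀ (l₁ l₂ : List Bool) (a : ℕ), l₁.length ≤ a →
    (l₁ ++ l₂).drop a = l₂.drop (a - l₁.length)
  | [], l₂, a, _ => by simp
  | b :: l₁, l₂, 0, h => by simp at h
  | b :: l₁, l₂, a + 1, h => by
    rw [List.cons_append, List.drop_succ_cons, List.length_cons,
      drop_append_of_length_le' l₁ l₂ a (by simpa using h), Nat.add_sub_add_right]

/-- Coins beyond a block do not see the block. [folklore] -/
theorem drop_mid_eq {ℓ a : ℕ} {pre v v' post : List Bool} (hv : v.length = ℓ) (hv' : v'.length = ℓ)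
    (ha : pre.length + ℓ ≤ a) : (pre ++ v ++ post).drop a = (pre ++ v' ++ post).drop a := by
  rw [drop_append_of_length_le' (pre ++ v) post a (by simp; omega),
    drop_append_of_length_le' (pre ++ v') post a (by simp; omega)]
  simp [hv, hv']

/-- Blocks other than block `i` do not see block `i`. [folklore] -/
theorem blk_eq_of_ne {ℓ i j : ℕ} {pre v v' post : List Bool} (hpre : pre.length = i * ℓ)
    (hv : v.length = ℓ) (hv' : v'.length = ℓ) (hij : j ≠ i) :
    blk ℓ j (pre ++ v ++ post) = blk ℓ j (pre ++ v' ++ post) := by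
  unfold blk
  rcases lt_or_gt_of_ne hij with h | h
  · -- block `j` lies inside `pre`
    have hjl : j * ℓ + ℓ ≤ i * ℓ := by
      have : (j + 1) * ℓ ≤ i * ℓ := Nat.mul_le_mul_right ℓ h
      rwa [Nat.succ_mul] at this
    rw [List.append_assoc, List.append_assoc,
      List.drop_append_of_le_length (by omega), List.drop_append_of_le_length (by omega),
      List.take_append_of_le_length (by simp; omega), List.take_append_of_le_length (by simp; omega)]
  · -- block `j` lies inside `post`
    have hjl : i * ℓ + ℓ ≤ j * ℓ := by
      have : (i + 1) * ℓ ≤ j * ℓ := Nat.mul_le_mul_right ℓ h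
      rwa [Nat.succ_mul] at this
    rw [drop_mid_eq hv hv' (by omega)]

end Lists

/-! ### The numerical parameters of the simulation -/

section Params

variable (q cM cF : Polynomial ℕ) (x : List Bool) (kη kδ : ℕ)

/-- The header `⟨x, ⟨1⁰, ⟨1^{kη}, 1^{2kδ}⟩⟩⟩` of the reduction's input (confidence doubled). [folklore] -/
def hdr2 : List Bool :=
  boolPair x (boolPair (unaryEncodeNat 0) (boolPair (unaryEncodeNat kη) (unaryEncodeNat (kδ + kδ))))

/-- The reduction's coin length `c_M(|x| + kη + 2kδ)`. [folklore] -/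
def LM : ℕ := cM.eval (x.length + kη + (kδ + kδ))

/-- The length of the reduction's input `⟨hdr2, u⟩`, `|u| = LM`. [folklore] -/
def nW : ℕ := 2 * (hdr2 x kη kδ).length + 2 + LM cM x kη kδ

/-- The reduction's round and query budget `Q = q(nW)`. [folklore] -/
def Qn : ℕ := q.eval (nW cM x kη kδ)

/-- The confidence `K = nW · Q + 1 ≥ 2kδ · Q + 1` of each simulated oracle call. [folklore] -/
def Kn : ℕ := nW cM x kη kδ * Qn q cM x kη kδ + 1

/-- The coin block length `ℓ = c_F(Q + K)` of each simulated oracle call. [folklore] -/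
def elln : ℕ := cF.eval (Qn q cM x kη kδ + Kn q cM x kη kδ)

/-- The reduction's own coins: after the `Q` blocks. [folklore] -/
def uOf (U : List Bool) : List Bool :=
  (U.drop (Qn q cM x kη kδ * elln q cM cF x kη kδ)).take (LM cM x kη kδ)

/-- The reduction's input `w = ⟨x, 1⁰, 1^{kη}, 1^{2kδ}, u⟩`. [folklore] -/
def wOf (U : List Bool) : List Bool := countQuery x 0 kη (kδ + kδ) (uOf q cM cF x kη kδ U)

/-- `countQuery x 0 kη (2kδ) u = ⟨hdr2, u⟩`. [folklore] -/
theorem countQuery_eq_hdr2 (u : List Bool) : countQuery x 0 kη (kδ + kδ) u = boolPair (hdr2 x kη kδ) u := rfl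

/-- `|hdr2| = 2|x| + 2kη + 2kδ + 6`. [folklore] -/
theorem length_hdr2 : (hdr2 x kη kδ).length = 2 * x.length + 2 * kη + (kδ + kδ) + 6 := by
  simp only [hdr2, length_boolPair, length_unary]
  omega

/-- The length of the reduction's input. [folklore] -/
theorem length_countQuery_two {u : List Bool} (hu : u.length = LM cM x kη kδ) :
    (countQuery x 0 kη (kδ + kδ) u).length = nW cM x kη kδ := by
  rw [countQuery_eq_hdr2, length_boolPair, hu, nW]

/-- The length of the FPRAS query `⟨x, 1⁰, 1^{kη}, 1^{kδ}, U⟩`. [folklore] -/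
theorem length_countQuery_one (U : List Bool) :
    (countQuery x 0 kη kδ U).length = 2 * (2 * x.length + 2 * kη + kδ + 6) + 2 + U.length := by
  simp only [countQuery, length_boolPair, length_unary]
  omega

/-! Polynomial bounds in `n₀ = |x| + kη + kδ`. -/

/-- Bound for `LM`. [folklore] -/
def LMB : Polynomial ℕ := cM.comp (2 * X)

/-- Bound for `nW`. [folklore] -/
def NWB : Polynomial ℕ := 4 * X + 14 + LMB cM

/-- Bound for `Q`. [folklore] -/
def QB : Polynomial ℕ := q.comp (NWB cM)

/-- Bound for `K`. [folklore] -/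
def KB : Polynomial ℕ := NWB cM * QB q cM + 1

/-- Bound for `ℓ`. [folklore] -/
def LB : Polynomial ℕ := cF.comp (QB q cM + KB q cM)

/-- **The coin budget of the FPRAS for `N`**: `Q` blocks of length `ℓ`, the reduction's `LM` coins,
and slack `2kδ` making the reduction's input no longer than the query. [folklore] -/
def cStar : Polynomial ℕ := QB q cM * LB q cM cF + LMB cM + 2 * X

/-- `LM` is bounded by its polynomial in `|x| + kη + kδ`. [folklore] -/
theorem LM_le : LM cM x kη kδ ≤ (LMB cM).eval (x.length + kη + kδ) := by
  simp only [LM, LMB, eval_comp, eval_mul, eval_ofNat, eval_X]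
  exact TM2Iter.eval_mono cM (by omega)

/-- `nW` is bounded by its polynomial in `|x| + kη + kδ`. [folklore] -/
theorem nW_le : nW cM x kη kδ ≤ (NWB cM).eval (x.length + kη + kδ) := by
  have h := LM_le cM x kη kδ
  simp only [NWB, eval_add, eval_mul, eval_ofNat, eval_X]
  rw [nW, length_hdr2]
  omega

/-- `Qn` is bounded by its polynomial in `|x| + kη + kδ`. [folklore] -/
theorem Qn_le : Qn q cM x kη kδ ≤ (QB q cM).eval (x.length + kη + kδ) := by
  simp only [Qn, QB, eval_comp]
  exact TM2Iter.eval_mono q (nW_le cM x kη kδ)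

/-- `Kn` is bounded by its polynomial in `|x| + kη + kδ`. [folklore] -/
theorem Kn_le : Kn q cM x kη kδ ≤ (KB q cM).eval (x.length + kη + kδ) := by
  simp only [Kn, KB, eval_add, eval_mul, eval_one]
  exact Nat.add_le_add_right (Nat.mul_le_mul (nW_le cM x kη kδ) (Qn_le q cM x kη kδ)) 1

/-- `elln` is bounded by its polynomial in `|x| + kη + kδ`. [folklore] -/
theorem elln_le : elln q cM cF x kη kδ ≤ (LB q cM cF).eval (x.length + kη + kδ) := by
  simp only [elln, LB, eval_comp, eval_add]
  exact TM2Iter.eval_mono cF (Nat.add_le_add (Qn_le q cM x kη kδ) (Kn_le q cM x kη kδ))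

/-- The coin budget covers the blocks and the reduction's coins. [folklore] -/
theorem blocks_add_LM_le :
    Qn q cM x kη kδ * elln q cM cF x kη kδ + LM cM x kη kδ ≤ (cStar q cM cF).eval (x.length + kη + kδ) := by
  simp only [cStar, eval_add, eval_mul, eval_ofNat, eval_X]
  have h1 := Nat.mul_le_mul (Qn_le q cM x kη kδ) (elln_le q cM cF x kη kδ)
  have h2 := LM_le cM x kη kδ
  omega

/-- The reduction's input is no longer than the FPRAS query. [folklore] -/
theorem nW_le_length_countQuery {U : List Bool} (hU : U.length = (cStar q cM cF).eval (x.length + kη + kδ)) :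
    nW cM x kη kδ ≤ (countQuery x 0 kη kδ U).length := by
  rw [length_countQuery_one, hU, nW, length_hdr2]
  have h2 := LM_le cM x kη kδ
  have : (LMB cM).eval (x.length + kη + kδ) + 2 * (x.length + kη + kδ) ≤
      (cStar q cM cF).eval (x.length + kη + kδ) := by
    simp only [cStar, eval_add, eval_mul, eval_ofNat, eval_X]
    omega
  omega

/-- `nW ≥ 2kδ`, so `K ≥ 2kδ · Q + 1`. [folklore] -/
theorem two_kδ_mul_Qn_lt_Kn : (kδ + kδ) * Qn q cM x kη kδ < Kn q cM x kη kδ := by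
  have h : kδ + kδ ≤ nW cM x kη kδ := by
    rw [nW, length_hdr2]; omega
  unfold Kn
  have := Nat.mul_le_mul_right (Qn q cM x kη kδ) h
  omega

end Params

/-! ### The string functions of the simulation -/

section Bricks

variable (q cM cF : Polynomial ℕ) (F : List Bool → List Bool)

/-- `x` off the FPRAS query `W = ⟨⟨x, ⟨1⁰, ⟨1^{kη}, 1^{kδ}⟩⟩⟩, U⟩`. [folklore] -/
def xF : List Bool → List Bool := fstF ∘ fstF
/-- `1^{kη}` off `W`. [folklore] -/
def etaF : List Bool → List Bool := nthF 2 ∘ fstF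
/-- `1^{kδ}` off `W`. [folklore] -/
def deltaF : List Bool → List Bool := sndPow 2 ∘ fstF
/-- `1^{2kδ}`. [folklore] -/
def delta2F : List Bool → List Bool := fun W => deltaF W ++ deltaF W
/-- The header `hdr2` of the reduction's input. [folklore] -/
def hdr2F : List Bool → List Bool := fanoutFn xF (fanoutFn (fun _ => []) (fanoutFn etaF delta2F))
/-- A string of length `|x| + kη + 2kδ`. [folklore] -/
def lenArgF : List Bool → List Bool := fun W => xF W ++ (fun W => etaF W ++ delta2F W) W
/-- `1^{LM}`. [folklore] -/
def LMUF : List Bool → List Bool := polyFn cM ∘ lenArgF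
/-- A string of length `nW` (`⟨hdr2, 1^{LM}⟩`). [folklore] -/
def nWF : List Bool → List Bool := fanoutFn hdr2F (LMUF cM)
/-- `1^{K}`. [folklore] -/
def KUF : List Bool → List Bool := polyFn (X * q + 1) ∘ nWF cM
/-- `1^{ℓ}`. [folklore] -/
def ellUF : List Bool → List Bool := polyFn (cF.comp (q + (X * q + 1))) ∘ nWF cM
/-- `1^{Qℓ}`. [folklore] -/
def QellUF : List Bool → List Bool := polyFn (q * cF.comp (q + (X * q + 1))) ∘ nWF cM
/-- The reduction's coins `u = (U ⇂ Qℓ) ↾ LM`. [folklore] -/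
def uF : List Bool → List Bool := takeFn ∘ fanoutFn (LMUF cM) (dropFn ∘ fanoutFn (QellUF q cM cF) sndF)
/-- The reduction's input `w = ⟨hdr2, u⟩`. [folklore] -/
def preF : List Bool → List Bool := fanoutFn hdr2F (uF q cM cF)

/-- On a record `r = ⟨W, ⟨1ⁱ, z⟩⟩`: the coin block `i` of `U`. [folklore] -/
def blkF : List Bool → List Bool :=
  takeFn ∘ fanoutFn (ellUF q cM cF ∘ fstF)
    (dropFn ∘ fanoutFn (umulFn ∘ fanoutFn (nthF 1) (ellUF q cM cF ∘ fstF)) (sndF ∘ fstF))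
/-- On a record: the instance `y` of the query `z = ⟨⟨y, ⟨1⁰, ⟨1ᵏ, 1¹⟩⟩⟩, ε⟩`. [folklore] -/
def yF : List Bool → List Bool := fstF ∘ fstF ∘ sndPow 1
/-- On a record: the accuracy field `1ᵏ` of the query. [folklore] -/
def kuF : List Bool → List Bool := nthF 2 ∘ fstF ∘ sndPow 1
/-- On a record: a string of length `|y| + k + K`. [folklore] -/
def coinLenArgF : List Bool → List Bool := fun r => yF r ++ (fun r => kuF r ++ (KUF q cM ∘ fstF) r) r
/-- On a record: the coins `vᵢ ↾ c_F(|y| + k + K)` of the simulated call. [folklore] -/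
def coinsF : List Bool → List Bool := takeFn ∘ fanoutFn (polyFn cF ∘ coinLenArgF q cM) (blkF q cM cF)
/-- On a record: the simulated oracle call `⟨⟨y, ⟨1⁰, ⟨1ᵏ, 1ᴷ⟩⟩⟩, coins⟩`. [folklore] -/
def queryF : List Bool → List Bool :=
  fanoutFn (fanoutFn yF (fanoutFn (fun _ => []) (fanoutFn kuF (KUF q cM ∘ fstF)))) (coinsF q cM cF)
/-- **The answer function**: the FPRAS transducer `F` on the simulated call. [folklore] -/
def ansF : List Bool → List Bool := F ∘ queryF q cM cF
/-- **The query map**: stamp the query with the round index, `⟨w, ⟨listBool E, z⟩⟩ ↦ ⟨1^{|E|}, z⟩`.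
[cite: AaronsonArkhipovToC2013, proof of Thm. 1.1 (p. 178)] -/
def dOne : List Bool → List Bool := fanoutFn (fstF ∘ nthF 1) (sndPow 1)

/-- **The FPRAS transducer for `N`**: the emulation (`OracleAlg.simFn`) of `M` with round-stamped
queries on the input `preF W`, answered by `ansF`. [cite: DyerEtAl2003, §1] -/
def Fstar (M : OracleAlg (List Bool)) : List Bool → List Bool :=
  OracleAlg.simFn (M.mapQuery dOne) (preF q cM cF) (ansF q cM cF F) (3 * q + 2) q

/-! Membership in `FP`. -/

/-- `xF ∈ FP`. [folklore] -/
theorem xF_mem_FP : xF ∈ FP := comp_mem_FP fstF_mem_FP fstF_mem_FP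
/-- `etaF ∈ FP`. [folklore] -/
theorem etaF_mem_FP : etaF ∈ FP := comp_mem_FP (nthF_mem_FP 2) fstF_mem_FP
/-- `deltaF ∈ FP`. [folklore] -/
theorem deltaF_mem_FP : deltaF ∈ FP := comp_mem_FP (sndPow_mem_FP 2) fstF_mem_FP
/-- `delta2F ∈ FP`. [folklore] -/
theorem delta2F_mem_FP : delta2F ∈ FP := append_mem_FP deltaF_mem_FP deltaF_mem_FP
/-- `hdr2F ∈ FP`. [folklore] -/
theorem hdr2F_mem_FP : hdr2F ∈ FP :=
  fanoutFn_mem_FP xF_mem_FP (fanoutFn_mem_FP (const_mem_FP _) (fanoutFn_mem_FP etaF_mem_FP delta2F_mem_FP))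
/-- `lenArgF ∈ FP`. [folklore] -/
theorem lenArgF_mem_FP : lenArgF ∈ FP :=
  append_mem_FP xF_mem_FP (append_mem_FP etaF_mem_FP delta2F_mem_FP)
/-- `LMUF ∈ FP`. [folklore] -/
theorem LMUF_mem_FP : LMUF cM ∈ FP := comp_mem_FP (polyFn_mem_FP cM) lenArgF_mem_FP
/-- `nWF ∈ FP`. [folklore] -/
theorem nWF_mem_FP : nWF cM ∈ FP := fanoutFn_mem_FP hdr2F_mem_FP (LMUF_mem_FP cM)
/-- `KUF ∈ FP`. [folklore] -/
theorem KUF_mem_FP : KUF q cM ∈ FP := comp_mem_FP (polyFn_mem_FP _) (nWF_mem_FP cM)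
/-- `ellUF ∈ FP`. [folklore] -/
theorem ellUF_mem_FP : ellUF q cM cF ∈ FP := comp_mem_FP (polyFn_mem_FP _) (nWF_mem_FP cM)
/-- `QellUF ∈ FP`. [folklore] -/
theorem QellUF_mem_FP : QellUF q cM cF ∈ FP := comp_mem_FP (polyFn_mem_FP _) (nWF_mem_FP cM)
/-- `uF ∈ FP`. [folklore] -/
theorem uF_mem_FP : uF q cM cF ∈ FP :=
  comp_mem_FP takeFn_mem_FP (fanoutFn_mem_FP (LMUF_mem_FP cM)
    (comp_mem_FP dropFn_mem_FP (fanoutFn_mem_FP (QellUF_mem_FP q cM cF) sndF_mem_FP)))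
/-- `preF ∈ FP`. [folklore] -/
theorem preF_mem_FP : preF q cM cF ∈ FP := fanoutFn_mem_FP hdr2F_mem_FP (uF_mem_FP q cM cF)
/-- `blkF ∈ FP`. [folklore] -/
theorem blkF_mem_FP : blkF q cM cF ∈ FP :=
  comp_mem_FP takeFn_mem_FP (fanoutFn_mem_FP (comp_mem_FP (ellUF_mem_FP q cM cF) fstF_mem_FP)
    (comp_mem_FP dropFn_mem_FP (fanoutFn_mem_FP
      (comp_mem_FP umulFn_mem_FP (fanoutFn_mem_FP (nthF_mem_FP 1) (comp_mem_FP (ellUF_mem_FP q cM cF) fstF_mem_FP)))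
      (comp_mem_FP sndF_mem_FP fstF_mem_FP))))
/-- `yF ∈ FP`. [folklore] -/
theorem yF_mem_FP : yF ∈ FP := comp_mem_FP fstF_mem_FP (comp_mem_FP fstF_mem_FP (sndPow_mem_FP 1))
/-- `kuF ∈ FP`. [folklore] -/
theorem kuF_mem_FP : kuF ∈ FP := comp_mem_FP (nthF_mem_FP 2) (comp_mem_FP fstF_mem_FP (sndPow_mem_FP 1))
/-- `coinLenArgF ∈ FP`. [folklore] -/
theorem coinLenArgF_mem_FP : coinLenArgF q cM ∈ FP :=
  append_mem_FP yF_mem_FP (append_mem_FP kuF_mem_FP (comp_mem_FP (KUF_mem_FP q cM) fstF_mem_FP))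
/-- `coinsF ∈ FP`. [folklore] -/
theorem coinsF_mem_FP : coinsF q cM cF ∈ FP :=
  comp_mem_FP takeFn_mem_FP (fanoutFn_mem_FP (comp_mem_FP (polyFn_mem_FP cF) (coinLenArgF_mem_FP q cM))
    (blkF_mem_FP q cM cF))
/-- `queryF ∈ FP`. [folklore] -/
theorem queryF_mem_FP : queryF q cM cF ∈ FP :=
  fanoutFn_mem_FP (fanoutFn_mem_FP yF_mem_FP (fanoutFn_mem_FP (const_mem_FP _)
    (fanoutFn_mem_FP kuF_mem_FP (comp_mem_FP (KUF_mem_FP q cM) fstF_mem_FP)))) (coinsF_mem_FP q cM cF)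
/-- `ansF ∈ FP`. [folklore] -/
theorem ansF_mem_FP {F : List Bool → List Bool} (hF : F ∈ FP) : ansF q cM cF F ∈ FP :=
  comp_mem_FP hF (queryF_mem_FP q cM cF)
/-- `dOne ∈ FP`. [folklore] -/
theorem dOne_mem_FP : dOne ∈ FP :=
  fanoutFn_mem_FP (comp_mem_FP fstF_mem_FP (nthF_mem_FP 1)) (sndPow_mem_FP 1)

/-- **`F⋆ ∈ FP`** (`OracleAlg.simFn_mem_FP`). [cite: AroraBarak2009, §3.4] -/
theorem Fstar_mem_FP {M : OracleAlg (List Bool)} (hM : M.IsPolyTime (encodingList Bool))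
    {F : List Bool → List Bool} (hF : F ∈ FP) : Fstar q cM cF F M ∈ FP :=
  OracleAlg.simFn_mem_FP (OracleAlg.isPolyTime_mapQuery (encodingList Bool) hM dOne_mem_FP)
    (preF_mem_FP q cM cF) (ansF_mem_FP q cM cF hF) _ _

/-! Values on the FPRAS query `W = countQuery x 0 kη kδ U` and on records `⟨W, ⟨1ⁱ, z⟩⟩`. -/

variable (x : List Bool) (kη kδ : ℕ) (U : List Bool)

/-- The value of `xF` on the FPRAS query `⟨x, 1⁰, 1^{kη}, 1^{kδ}, U⟩`. [folklore] -/
theorem xF_W : xF (countQuery x 0 kη kδ U) = x := by simp [xF, countQuery]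
/-- The value of `etaF` on the FPRAS query `⟨x, 1⁰, 1^{kη}, 1^{kδ}, U⟩`. [folklore] -/
theorem etaF_W : etaF (countQuery x 0 kη kδ U) = unaryEncodeNat kη := by simp [etaF, nthF, countQuery]
/-- The value of `deltaF` on the FPRAS query `⟨x, 1⁰, 1^{kη}, 1^{kδ}, U⟩`. [folklore] -/
theorem deltaF_W : deltaF (countQuery x 0 kη kδ U) = unaryEncodeNat kδ := by simp [deltaF, sndPow, countQuery]
/-- The value of `delta2F` on the FPRAS query `⟨x, 1⁰, 1^{kη}, 1^{kδ}, U⟩`. [folklore] -/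
theorem delta2F_W : delta2F (countQuery x 0 kη kδ U) = unaryEncodeNat (kδ + kδ) := by
  simp only [delta2F, deltaF_W, unary_append]
/-- The value of `hdr2F` on the FPRAS query `⟨x, 1⁰, 1^{kη}, 1^{kδ}, U⟩`. [folklore] -/
theorem hdr2F_W : hdr2F (countQuery x 0 kη kδ U) = hdr2 x kη kδ := by
  simp only [hdr2F, fanoutFn_apply, xF_W, etaF_W, delta2F_W, hdr2, unary_zero]
/-- The length of `lenArgF` on the FPRAS query: `|x| + kη + 2kδ`. [folklore] -/
theorem length_lenArgF_W : (lenArgF (countQuery x 0 kη kδ U)).length = x.length + kη + (kδ + kδ) := by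
  simp only [lenArgF, xF_W, etaF_W, delta2F_W, List.length_append, length_unary]
  omega
/-- The value of `LMUF` on the FPRAS query `⟨x, 1⁰, 1^{kη}, 1^{kδ}, U⟩`. [folklore] -/
theorem LMUF_W : LMUF cM (countQuery x 0 kη kδ U) = ones (LM cM x kη kδ) := by
  simp only [LMUF, Function.comp_apply, polyFn_apply, length_lenArgF_W, LM]
/-- The value of `nWF` on the FPRAS query `⟨x, 1⁰, 1^{kη}, 1^{kδ}, U⟩`. [folklore] -/
theorem nWF_W : nWF cM (countQuery x 0 kη kδ U) = boolPair (hdr2 x kη kδ) (ones (LM cM x kη kδ)) := by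
  simp only [nWF, fanoutFn_apply, hdr2F_W, LMUF_W]
/-- The length of `nWF` on the FPRAS query is `nW`. [folklore] -/
theorem length_nWF_W : (nWF cM (countQuery x 0 kη kδ U)).length = nW cM x kη kδ := by
  rw [nWF_W, length_boolPair, List.length_replicate, nW]
/-- The value of `KUF` on the FPRAS query `⟨x, 1⁰, 1^{kη}, 1^{kδ}, U⟩`. [folklore] -/
theorem KUF_W : KUF q cM (countQuery x 0 kη kδ U) = ones (Kn q cM x kη kδ) := by
  simp only [KUF, Function.comp_apply, polyFn_apply, length_nWF_W, eval_add, eval_mul, eval_X, eval_one, Kn, Qn]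
/-- The value of `ellUF` on the FPRAS query `⟨x, 1⁰, 1^{kη}, 1^{kδ}, U⟩`. [folklore] -/
theorem ellUF_W : ellUF q cM cF (countQuery x 0 kη kδ U) = ones (elln q cM cF x kη kδ) := by
  simp only [ellUF, Function.comp_apply, polyFn_apply, length_nWF_W, eval_comp, eval_add, eval_mul, eval_X,
    eval_one, elln, Kn, Qn]
/-- The value of `QellUF` on the FPRAS query `⟨x, 1⁰, 1^{kη}, 1^{kδ}, U⟩`. [folklore] -/
theorem QellUF_W : QellUF q cM cF (countQuery x 0 kη kδ U) = ones (Qn q cM x kη kδ * elln q cM cF x kη kδ) := by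
  simp only [QellUF, Function.comp_apply, polyFn_apply, length_nWF_W, eval_comp, eval_add, eval_mul, eval_X,
    eval_one, elln, Kn, Qn]
/-- The value of `uF` on the FPRAS query `⟨x, 1⁰, 1^{kη}, 1^{kδ}, U⟩`. [folklore] -/
theorem uF_W : uF q cM cF (countQuery x 0 kη kδ U) = uOf q cM cF x kη kδ U := by
  have hs : sndF (countQuery x 0 kη kδ U) = U := by simp [countQuery]
  simp only [uF, Function.comp_apply, fanoutFn_apply, LMUF_W, QellUF_W, hs, takeFn_boolPair, dropFn_boolPair,
    List.length_replicate, uOf]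
/-- **The emulation's input is the reduction's input** `w = ⟨x, 1⁰, 1^{kη}, 1^{2kδ}, u⟩`. [folklore] -/
theorem preF_W : preF q cM cF (countQuery x 0 kη kδ U) = wOf q cM cF x kη kδ U := by
  simp only [preF, fanoutFn_apply, hdr2F_W, uF_W, wOf, countQuery_eq_hdr2]

/-- The block read on a record `⟨W, ⟨s, z⟩⟩` is block `|s|` of `U`. [folklore] -/
theorem blkF_rec (s z : List Bool) :
    blkF q cM cF (boolPair (countQuery x 0 kη kδ U) (boolPair s z)) = blk (elln q cM cF x kη kδ) s.length U := by
  have hs : sndF (countQuery x 0 kη kδ U) = U := by simp [countQuery]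
  simp only [blkF, Function.comp_apply, fanoutFn_apply, fstF_boolPair, nthF_succ_boolPair, nthF_zero,
    ellUF_W, umulFn_apply, sndF_boolPair, List.length_replicate, hs, takeFn_boolPair, dropFn_boolPair, blk]

/-- **The answer function on a record** `⟨W, ⟨s, z⟩⟩`: `F` on `⟨⟨y, ⟨ε, ⟨ku, 1ᴷ⟩⟩⟩, blk |s| U ↾ c_F(|y|+|ku|+K)⟩`
with `y = fst (fst z)`, `ku = nth 2 (fst z)`. [folklore] -/
theorem ansF_rec (s z : List Bool) :
    ansF q cM cF F (boolPair (countQuery x 0 kη kδ U) (boolPair s z)) =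
      F (boolPair (boolPair (fstF (fstF z)) (boolPair [] (boolPair (nthF 2 (fstF z)) (ones (Kn q cM x kη kδ)))))
        ((blk (elln q cM cF x kη kδ) s.length U).take
          (cF.eval ((fstF (fstF z)).length + (nthF 2 (fstF z)).length + Kn q cM x kη kδ)))) := by
  simp only [ansF, queryF, coinsF, coinLenArgF, yF, kuF, Function.comp_apply, fanoutFn_apply, fstF_boolPair,
    sndPow_succ_boolPair, sndPow_zero_boolPair, KUF_W, blkF_rec, takeFn_boolPair, polyFn_apply,
    List.length_append, List.length_replicate, add_assoc]

/-- **The answer to a canonical counting query** `⟨y, 1⁰, 1ᵏ, 1¹, ε⟩` stamped with `s`: the FPRAS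
transducer on `⟨y, 1⁰, 1ᵏ, 1ᴷ, v⟩` with the coins `v = blk |s| U ↾ c_F(|y| + k + K)`.
[cite: AaronsonArkhipovToC2013, proof of Thm. 1.1 (p. 178)] -/
theorem ansF_canonical (s y : List Bool) (k : ℕ) :
    ansF q cM cF F (boolPair (countQuery x 0 kη kδ U) (boolPair s (countQuery y 0 k 1 []))) =
      F (countQuery y 0 k (Kn q cM x kη kδ)
        ((blk (elln q cM cF x kη kδ) s.length U).take (cF.eval (y.length + k + Kn q cM x kη kδ)))) := by
  rw [ansF_rec]
  simp only [countQuery, fstF_boolPair, nthF_succ_boolPair, nthF_zero, length_unary, unary_zero, ones_eq_unary]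

/-- **The query map stamps the round index.** [folklore] -/
theorem dOne_apply (w z : List Bool) (E : List (List Bool)) :
    dOne (boolPair w (boolPair ((encodingList Bool).listBool.encode E) z)) = boolPair (unaryEncodeNat E.length) z := by
  have hLB : fstF ((encodingList Bool).listBool.encode E) = unaryEncodeNat E.length := by
    simp [Encoding.listBool]
  simp only [dOne, fanoutFn_apply, Function.comp_apply, nthF_succ_boolPair, nthF_zero, fstF_boolPair, hLB,
    sndPow_succ_boolPair, sndPow_zero_boolPair]

end Bricks

/-! ### Pulling an FPRAS back along a count-preserving polynomial-time map -/

section Pullback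

variable (g : List Bool → List Bool) (c : Polynomial ℕ)

/-- The header `⟨g x, ⟨1⁰, ⟨1^{kη}, 1^{kδ}⟩⟩⟩` of the pulled-back query: the instance mapped, the
unary fields copied. [folklore] -/
def pbHdrF : List Bool → List Bool := fanoutFn (g ∘ xF) (sndF ∘ fstF)

/-- A string of length `|g x| + kη + kδ`. [folklore] -/
def pbLenF : List Bool → List Bool := fun W => (g ∘ xF) W ++ (fun W => etaF W ++ deltaF W) W

/-- The coins of the pulled-back query: `U ↾ c(|g x| + kη + kδ)`. [folklore] -/
def pbCoinsF : List Bool → List Bool := takeFn ∘ fanoutFn (polyFn c ∘ pbLenF g) sndF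

/-- **The pull-back map on FPRAS queries**: `⟨x, 1⁰, 1^{kη}, 1^{kδ}, U⟩ ↦ ⟨g x, 1⁰, 1^{kη}, 1^{kδ}, U ↾ c(|g x|+kη+kδ)⟩`.
[folklore] -/
def pbF : List Bool → List Bool := fanoutFn (pbHdrF g) (pbCoinsF g c)

variable {g}

/-- `pbHdrF g ∈ FP` for `g ∈ FP`. [folklore] -/
theorem pbHdrF_mem_FP (hg : g ∈ FP) : pbHdrF g ∈ FP :=
  fanoutFn_mem_FP (comp_mem_FP hg xF_mem_FP) (comp_mem_FP sndF_mem_FP fstF_mem_FP)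

/-- `pbLenF g ∈ FP` for `g ∈ FP`. [folklore] -/
theorem pbLenF_mem_FP (hg : g ∈ FP) : pbLenF g ∈ FP :=
  append_mem_FP (comp_mem_FP hg xF_mem_FP) (append_mem_FP etaF_mem_FP deltaF_mem_FP)

/-- `pbCoinsF g c ∈ FP` for `g ∈ FP`. [folklore] -/
theorem pbCoinsF_mem_FP (hg : g ∈ FP) (c : Polynomial ℕ) : pbCoinsF g c ∈ FP :=
  comp_mem_FP takeFn_mem_FP (fanoutFn_mem_FP (comp_mem_FP (polyFn_mem_FP c) (pbLenF_mem_FP hg)) sndF_mem_FP)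

/-- `pbF g c ∈ FP` for `g ∈ FP`. [folklore] -/
theorem pbF_mem_FP (hg : g ∈ FP) (c : Polynomial ℕ) : pbF g c ∈ FP :=
  fanoutFn_mem_FP (pbHdrF_mem_FP hg) (pbCoinsF_mem_FP hg c)

variable (g)

/-- **The value of the pull-back map on an FPRAS query.** [folklore] -/
theorem pbF_W (x : List Bool) (kη kδ : ℕ) (U : List Bool) :
    pbF g c (countQuery x 0 kη kδ U) = countQuery (g x) 0 kη kδ (U.take (c.eval ((g x).length + kη + kδ))) := by
  have hs : sndF (countQuery x 0 kη kδ U) = U := by simp [countQuery]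
  have hh : sndF (fstF (countQuery x 0 kη kδ U)) =
      boolPair (unaryEncodeNat 0) (boolPair (unaryEncodeNat kη) (unaryEncodeNat kδ)) := by
    simp [countQuery]
  have hlen : (pbLenF g (countQuery x 0 kη kδ U)).length = (g x).length + kη + kδ := by
    simp only [pbLenF, Function.comp_apply, xF_W, etaF_W, deltaF_W, List.length_append, length_unary]
    omega
  simp only [pbF, pbHdrF, pbCoinsF, fanoutFn_apply, Function.comp_apply, xF_W, hh, hs, polyFn_apply, hlen, takeFn_boolPair,
    List.length_replicate]
  rfl

end Pullback

/-! ### The transfer theorem -/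

section Transfer

open OracleAlg

variable (M : OracleAlg (List Bool)) (q cM cF : Polynomial ℕ) (F : List Bool → List Bool)
  (x : List Bool) (kη kδ : ℕ)

/-- **The simulated answer rule** on the coin string `U`: the query `z` after `|E|` answers is answered
by `ansF ⟨W, ⟨1^{|E|}, z⟩⟩`, `W = ⟨x, 1⁰, 1^{kη}, 1^{kδ}, U⟩`. [folklore] -/
def rho (U : List Bool) : Rule := fun E z =>
  ansF q cM cF F (boolPair (countQuery x 0 kη kδ U) (boolPair (unaryEncodeNat E.length) z))

/-- The transcript of the simulated run after `j` rounds. [folklore] -/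
def Etr (U : List Bool) (j : ℕ) : List (List Bool) :=
  traceR M (wOf q cM cF x kη kδ U) (rho q cM cF F x kη kδ U) j

/-- **Round `i` is bad**: the reduction asks a canonical counting query and the simulated answer is
out of tolerance. [folklore] -/
def BadAt (N' : List Bool → ℕ) (i : ℕ) (U : List Bool) : Prop :=
  ∃ z, M.step (wOf q cM cF x kη kδ U) (Etr M q cM cF F x kη kδ U i) = Sum.inl z ∧
    ∃ (y : List Bool) (k : ℕ), 0 < k ∧ z = countQuery y 0 k 1 [] ∧
      ¬ IsApproxCount k (N' y) (decodeNat (rho q cM cF F x kη kδ U (Etr M q cM cF F x kη kδ U i) z))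

/-- **The reduction's coins are bad**: against some approximate-counting rule the run at confidence
`2kδ` fails (the event of clause (ii) of `APReducible`). [folklore] -/
def BadM (N N' : List Bool → ℕ) : Set (List Bool) :=
  {u | ∃ R : Rule, IsApproxCountRule N' R ∧
      ¬ ∃ a, M.runRule (countQuery x 0 kη (kδ + kδ) u) R
              (q.eval (countQuery x 0 kη (kδ + kδ) u).length) [] = some a ∧
            IsApproxCount kη (N x) (decodeNat a)}

variable {M q cM cF F x kη kδ}
variable {N N' : List Bool → ℕ}

/-- The rule does not read blocks other than block `|E|`. [folklore] -/
theorem rho_eq_of_blk_eq {U U' : List Bool} {E : List (List Bool)}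
    (h : blk (elln q cM cF x kη kδ) E.length U = blk (elln q cM cF x kη kδ) E.length U') (z : List Bool) :
    rho q cM cF F x kη kδ U E z = rho q cM cF F x kη kδ U' E z := by
  simp only [rho, ansF_rec, length_unary, h]

/-- **Good coin strings give a good estimate.** If the reduction's coins `u` are good (clause (ii)
holds for every approximate-counting rule) and no round `< Q` is bad, then `F⋆` answers within
`1 + 1/kη` of `N x`: the rule "simulated answer along the run, exact count elsewhere" is an
approximate-counting rule for `N'`, the run under it is the simulated run (locality), and the
emulation computes that run (`simFn_eq_of_run`). [cite: DyerEtAl2003, §1] -/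
theorem isApproxCount_of_good
    (hq : ∀ (w : List Bool) (E : List (List Bool)) (z : List Bool), M.step w E = Sum.inl z → z.length ≤ q.eval w.length)
    {U : List Bool} (hU : U.length = (cStar q cM cF).eval (x.length + kη + kδ))
    (hgoodu : uOf q cM cF x kη kδ U ∉ BadM M q x kη kδ N N')
    (hgoodb : ∀ i < Qn q cM x kη kδ, ¬ BadAt M q cM cF F x kη kδ N' i U) :
    IsApproxCount kη (N x) (countEstimate (Fstar q cM cF F M) x 0 kη kδ U) := by
  have hcover := blocks_add_LM_le q cM cF x kη kδ
  have hulen : (uOf q cM cF x kη kδ U).length = LM cM x kη kδ := by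
    unfold uOf
    rw [List.length_take, List.length_drop, hU]
    omega
  have hwlen : (wOf q cM cF x kη kδ U).length = nW cM x kη kδ := length_countQuery_two cM x kη kδ hulen
  have hqw : q.eval (wOf q cM cF x kη kδ U).length = Qn q cM x kη kδ := by rw [hwlen, Qn]
  -- the valid rule agreeing with `rho U` along the run
  obtain ⟨Rstar, hRstar⟩ : ∃ Rstar : Rule, Rstar = fun E z =>
      if (∃ j < Qn q cM x kη kδ, E = Etr M q cM cF F x kη kδ U j ∧ M.step (wOf q cM cF x kη kδ U) E = Sum.inl z)
      then rho q cM cF F x kη kδ U E z else exactCountRule N' E z := ⟨_, rfl⟩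
  have hvalid : IsApproxCountRule N' Rstar := by
    intro E y k hk
    by_cases hc : ∃ j < Qn q cM x kη kδ, E = Etr M q cM cF F x kη kδ U j ∧
        M.step (wOf q cM cF x kη kδ U) E = Sum.inl (countQuery y 0 k 1 [])
    · have hif : Rstar E (countQuery y 0 k 1 []) = rho q cM cF F x kη kδ U E (countQuery y 0 k 1 []) := by
        rw [hRstar]; exact if_pos hc
      rw [hif]
      obtain ⟨j, hj, rfl, hstep⟩ := hc
      by_contra hbad
      exact hgoodb j hj ⟨_, hstep, y, k, hk, rfl, hbad⟩
    · have hif : Rstar E (countQuery y 0 k 1 []) = exactCountRule N' E (countQuery y 0 k 1 []) := by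
        rw [hRstar]; exact if_neg hc
      rw [hif]
      exact isApproxCountRule_exactCountRule N' E y k hk
  -- clause (ii) of the reduction for this rule
  have hrun : ∃ a, M.runRule (wOf q cM cF x kη kδ U) Rstar (Qn q cM x kη kδ) [] = some a ∧
      IsApproxCount kη (N x) (decodeNat a) := by
    by_contra hno
    refine hgoodu ⟨Rstar, hvalid, ?_⟩
    rw [← wOf, hqw]
    exact hno
  obtain ⟨a, ha, happrox⟩ := hrun
  -- locality: the simulated rule runs the same way
  have hρrun : M.runRule (wOf q cM cF x kη kδ U) (rho q cM cF F x kη kδ U) (Qn q cM x kη kδ) [] = some a := by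
    rw [← ha]
    refine runRule_congr M _ _ fun j hj z hstep => ?_
    rw [hRstar]
    exact (if_pos ⟨j, hj, rfl, hstep⟩).symm
  -- the emulated oracle algorithm with the answer function
  have hmrun : (M.mapQuery dOne).run (fun r => ansF q cM cF F (boolPair (countQuery x 0 kη kδ U) r))
      (Qn q cM x kη kδ) (wOf q cM cF x kη kδ U) = some a := by
    have hρO : (fun (E : List (List Bool)) (z : List Bool) =>
        ansF q cM cF F (boolPair (countQuery x 0 kη kδ U)
          (dOne (boolPair (wOf q cM cF x kη kδ U) (boolPair ((encodingList Bool).listBool.encode E) z))))) =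
        rho q cM cF F x kη kδ U := by
      funext E z
      simp only [rho, dOne_apply]
    rw [run_mapQuery_eq_runRule, hρO, hρrun]
  have hnW : nW cM x kη kδ ≤ (countQuery x 0 kη kδ U).length := nW_le_length_countQuery q cM cF x kη kδ hU
  have hQle : Qn q cM x kη kδ ≤ q.eval (countQuery x 0 kη kδ U).length := TM2Iter.eval_mono q hnW
  have hpre : preF q cM cF (countQuery x 0 kη kδ U) = wOf q cM cF x kη kδ U := preF_W q cM cF x kη kδ U
  have hmrun' : (M.mapQuery dOne).run (fun r => ansF q cM cF F (boolPair (countQuery x 0 kη kδ U) r))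
      (q.eval (countQuery x 0 kη kδ U).length) (preF q cM cF (countQuery x 0 kη kδ U)) = some a := by
    rw [hpre]; exact run_mono _ _ _ hQle hmrun
  have hqbd : ∀ r ∈ (M.mapQuery dOne).queries (fun r => ansF q cM cF F (boolPair (countQuery x 0 kη kδ U) r))
      (q.eval (countQuery x 0 kη kδ U).length) (preF q cM cF (countQuery x 0 kη kδ U)),
      r.length ≤ (3 * q + 2).eval (countQuery x 0 kη kδ U).length := by
    intro r hr
    rw [hpre] at hr
    have hmem := mem_queries_mapQuery M dOne _ _ _ r hr
    obtain ⟨E', z, hstep, hlen, hr'⟩ := hmem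
    rw [hr', dOne_apply, length_boolPair, length_unary]
    have hz : z.length ≤ Qn q cM x kη kδ := by rw [← hqw]; exact hq _ E' z hstep
    simp only [eval_add, eval_mul, eval_ofNat]
    omega
  have hF : Fstar q cM cF F M (countQuery x 0 kη kδ U) = a := simFn_eq_of_run hmrun' hqbd
  rw [countEstimate_def, hF]
  exact happrox

/-- **A block is bad with probability `≤ 1/K`, whatever the coins outside it.** With the coins
before and after block `i` fixed, the run up to round `i` is fixed (it reads only earlier blocks and
the reduction's coins, `traceR_congr`); if its round-`i` query is canonical, `⟨y, 1⁰, 1ᵏ, 1¹, ε⟩`, the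
block is bad exactly when `F` on `⟨y, 1⁰, 1ᵏ, 1ᴷ, v ↾ c_F(|y|+k+K)⟩` errs, which has probability `≤ 1/K`
(`HasFPRAS N'` at confidence `K`; a prefix of a uniform block is uniform); otherwise never.
[cite: AaronsonArkhipovToC2013, proof of Thm. 1.1 (p. 178)] [cite: AroraBarak2009, §7.4.1] -/
theorem uniformProb_badBlock_le
    (hq : ∀ (w : List Bool) (E : List (List Bool)) (z : List Bool), M.step w E = Sum.inl z → z.length ≤ q.eval w.length)
    (hFgood : ∀ (y : List Bool) (k : ℕ), 0 < k →
      uniformProb (cF.eval (y.length + k + Kn q cM x kη kδ))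
        {v | ¬ IsApproxCount k (N' y) (countEstimate F y 0 k (Kn q cM x kη kδ) v)} ≤ 1 / (Kn q cM x kη kδ : ℝ))
    {i : ℕ} (hi : i < Qn q cM x kη kδ) {pre post : List Bool} (hpre : pre.length = i * elln q cM cF x kη kδ)
    {m : ℕ} (hm : Qn q cM x kη kδ * elln q cM cF x kη kδ + LM cM x kη kδ ≤ m)
    (hpost : post.length = m - (i * elln q cM cF x kη kδ + elln q cM cF x kη kδ)) :
    uniformProb (elln q cM cF x kη kδ) {v | BadAt M q cM cF F x kη kδ N' i (pre ++ v ++ post)} ≤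
      1 / (Kn q cM x kη kδ : ℝ) := by
  -- independence: outside coins fixed, the run up to round `i` is fixed
  set ℓ := elln q cM cF x kη kδ with hℓ
  set Q := Qn q cM x kη kδ with hQ
  set K := Kn q cM x kη kδ with hK
  set v₀ : List Bool := List.replicate ℓ false with hv₀
  have hv₀l : v₀.length = ℓ := by simp [hv₀]
  have hQl : pre.length + ℓ ≤ Q * ℓ := by
    have : (i + 1) * ℓ ≤ Q * ℓ := Nat.mul_le_mul_right ℓ hi
    rw [Nat.succ_mul] at this; omega
  have huOf : ∀ v : List Bool, v.length = ℓ →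
      uOf q cM cF x kη kδ (pre ++ v ++ post) = uOf q cM cF x kη kδ (pre ++ v₀ ++ post) := by
    intro v hv
    unfold uOf
    rw [drop_mid_eq hv hv₀l hQl]
  have hwv : ∀ v : List Bool, v.length = ℓ → wOf q cM cF x kη kδ (pre ++ v ++ post) = wOf q cM cF x kη kδ (pre ++ v₀ ++ post) := by
    intro v hv; simp only [wOf, huOf v hv]
  have hEtr : ∀ v : List Bool, v.length = ℓ →
      Etr M q cM cF F x kη kδ (pre ++ v ++ post) i = Etr M q cM cF F x kη kδ (pre ++ v₀ ++ post) i := by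
    intro v hv
    unfold Etr
    rw [hwv v hv]
    refine traceR_congr M _ i (fun j hj z hstep => ?_) i le_rfl
    have hlenj := length_traceR_of_step_inl M _ _ j hstep
    exact rho_eq_of_blk_eq (blk_eq_of_ne hpre hv hv₀l (by rw [hlenj]; exact Nat.ne_of_lt hj)) z
  -- the reduction's input on the fixed coins has the expected length
  have hul : (uOf q cM cF x kη kδ (pre ++ v₀ ++ post)).length = LM cM x kη kδ := by
    unfold uOf
    rw [← hQ, ← hℓ, List.length_take, List.length_drop, List.length_append, List.length_append, hpre, hv₀l, hpost]
    omega
  have hqw : q.eval (wOf q cM cF x kη kδ (pre ++ v₀ ++ post)).length = Q := by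
    rw [wOf, length_countQuery_two cM x kη kδ hul, hQ, Qn]
  -- case on whether round `i` of the fixed run asks a canonical query
  by_cases hcase : ∃ z₀, M.step (wOf q cM cF x kη kδ (pre ++ v₀ ++ post)) (Etr M q cM cF F x kη kδ (pre ++ v₀ ++ post) i) =
      Sum.inl z₀ ∧ ∃ (y₀ : List Bool) (k₀ : ℕ), 0 < k₀ ∧ z₀ = countQuery y₀ 0 k₀ 1 []
  · obtain ⟨z₀, hz₀, y₀, k₀, hk₀, rfl⟩ := hcase
    -- the call's coins fit in the block
    have hℓ'le : cF.eval (y₀.length + k₀ + K) ≤ ℓ := by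
      have hzlen : (countQuery y₀ 0 k₀ 1 []).length ≤ Q := by rw [← hqw]; exact hq _ _ _ hz₀
      have hyk : y₀.length + k₀ ≤ (countQuery y₀ 0 k₀ 1 []).length := by
        simp only [countQuery, length_boolPair, length_unary]; omega
      rw [hℓ, elln]
      exact TM2Iter.eval_mono cF (by omega)
    have hlen : (Etr M q cM cF F x kη kδ (pre ++ v₀ ++ post) i).length = i := length_traceR_of_step_inl M _ _ i hz₀
    refine le_trans (uniformProb_mono_len fun v hv hbad => ?_)
      (uniformProb_take_le_of_le hℓ'le {v' | ¬ IsApproxCount k₀ (N' y₀) (countEstimate F y₀ 0 k₀ K v')}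
        (hFgood y₀ k₀ hk₀))
    -- a bad block makes the call on `y₀` fail with the block's prefix as coins
    obtain ⟨z, hz, y, k, hk, rfl, hnot⟩ := hbad
    rw [hEtr v hv, hwv v hv, hz₀] at hz
    obtain ⟨rfl, rfl⟩ := countQuery_canonical_inj (Sum.inl_injective hz)
    rw [hEtr v hv] at hnot
    simp only [rho, ansF_canonical, length_unary, hlen] at hnot
    rw [← hℓ, ← hK, blk_mid hpre hv] at hnot
    simpa only [Set.mem_setOf_eq, countEstimate_def] using hnot
  · -- no canonical query at round `i`: no block is bad
    refine le_trans (uniformProb_mono_len (E' := ∅) fun v hv hbad => ?_) (by simp)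
    obtain ⟨z, hz, y, k, hk, rfl, -⟩ := hbad
    rw [hEtr v hv, hwv v hv] at hz
    exact absurd ⟨_, hz, y, k, hk, rfl⟩ hcase

/-- **An AP-reduction pulls an FPRAS back** (the point of Dyer–Goldberg–Greenhill–Jerrum's
definition, §1: from `f ≤_AP g` and an FPRAS for `g`, an FPRAS for `f`), for the tree's `APReducible`
and `HasFPRAS`: simulate the reduction at confidence `2kδ`, answering its `i`-th oracle call by the
FPRAS transducer for `N'` run at confidence `K ≥ 2kδ · #calls` on the fresh coin block `i`; the coin
strings on which the reduction errs against some valid oracle, or some answer is out of tolerance,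
have probability `≤ 1/(2kδ) + #calls/K ≤ 1/kδ` (fresh blocks, union bound), and on the others the
answers given form an approximate-counting rule along the run, so the output is within `1 + 1/kη`.
[cite: DyerEtAl2003, §1 (definition of AP-reduction, "if … g has an FPRAS then so does f")]
[cite: AaronsonArkhipovToC2013, proof of Thm. 1.1 (p. 178)] -/
theorem hasFPRAS_of_apReducible (hred : APReducible N N') (hF : HasFPRAS N') : HasFPRAS N := by
  obtain ⟨M, hM, q, cM, hq, hgood⟩ := hred
  obtain ⟨F, hFP, cF, hFgood⟩ := hF
  refine ⟨Fstar q cM cF F M, Fstar_mem_FP q cM cF hM hFP, cStar q cM cF, fun x kη kδ hkη hkδ => ?_⟩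
  -- abbreviations
  set m := (cStar q cM cF).eval (x.length + kη + kδ) with hm
  set Q := Qn q cM x kη kδ with hQ
  set K := Kn q cM x kη kδ with hK
  set ℓ := elln q cM cF x kη kδ with hℓ
  set L := LM cM x kη kδ with hL
  have hkδ2 : 0 < kδ + kδ := by omega
  have hKpos : 0 < K := by rw [hK, Kn]; omega
  have hmcover : Q * ℓ + L ≤ m := blocks_add_LM_le q cM cF x kη kδ
  -- (2) the reduction's own coins are bad with probability ≤ 1/(2kδ)
  have hBadM : uniformProb L (BadM M q x kη kδ N N') ≤ 1 / ((kδ + kδ : ℕ) : ℝ) := hgood x kη (kδ + kδ) hkη hkδ2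
  obtain ⟨d, hd⟩ : ∃ d, m = Q * ℓ + L + d := ⟨m - (Q * ℓ + L), by omega⟩
  have hU2 : uniformProb m {U | uOf q cM cF x kη kδ U ∈ BadM M q x kη kδ N N'} ≤ 1 / ((kδ + kδ : ℕ) : ℝ) := by
    rw [hd]
    exact uniformProb_block_le' (a := Q * ℓ) (ℓ := L) (d := d) (fun _ _ => BadM M q x kη kδ N N')
      fun _ _ _ _ => hBadM
  -- (3) some simulated answer is out of tolerance with probability ≤ Q/K
  set B : ℕ → List Bool → List Bool → Set (List Bool) :=
    fun i pre post => {v | BadAt M q cM cF F x kη kδ N' i (pre ++ v ++ post)} with hB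
  have hU3 : uniformProb m {U | ∃ i < Q, (U.drop (i * ℓ)).take ℓ ∈ B i (U.take (i * ℓ)) (U.drop (i * ℓ + ℓ))} ≤
      Q * (1 / (K : ℝ)) :=
    uniformProb_exists_badBlock_le' (by omega) B fun i hi pre post hpre hpost =>
      uniformProb_badBlock_le hq (fun y k hk => hFgood y k K hk hKpos) hi hpre hmcover hpost
  -- (4) assembly: failure ⊆ (2) ∪ (3), and 1/(2kδ) + Q/K ≤ 1/kδ
  have hsub : uniformProb m {U | ¬ IsApproxCount kη (N x) (countEstimate (Fstar q cM cF F M) x 0 kη kδ U)} ≤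
      uniformProb m ({U | uOf q cM cF x kη kδ U ∈ BadM M q x kη kδ N N'} ∪
        {U | ∃ i < Q, (U.drop (i * ℓ)).take ℓ ∈ B i (U.take (i * ℓ)) (U.drop (i * ℓ + ℓ))}) := by
    refine uniformProb_mono_len fun U hU hfail => ?_
    by_contra hgoodU
    simp only [Set.mem_union, Set.mem_setOf_eq, not_or, not_exists, not_and] at hgoodU
    refine hfail (isApproxCount_of_good hq hU hgoodU.1 fun i hi hbad => hgoodU.2 i hi ?_)
    simp only [hB, Set.mem_setOf_eq, take_append_blk_append_drop]
    exact hbad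
  have hQK : (Q : ℝ) * (1 / (K : ℝ)) ≤ 1 / ((kδ + kδ : ℕ) : ℝ) := by
    have hlt := two_kδ_mul_Qn_lt_Kn q cM x kη kδ
    rw [← hQ, ← hK] at hlt
    have hKr : (0 : ℝ) < K := by exact_mod_cast hKpos
    have hkr : (0 : ℝ) < ((kδ + kδ : ℕ) : ℝ) := by exact_mod_cast hkδ2
    have hle : (Q : ℝ) * ((kδ + kδ : ℕ) : ℝ) ≤ (K : ℝ) := by exact_mod_cast (by rw [Nat.mul_comm]; exact hlt.le)
    rw [mul_one_div, div_le_div_iff₀ hKr hkr, one_mul]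
    exact hle
  have hhalf : 1 / ((kδ + kδ : ℕ) : ℝ) + 1 / ((kδ + kδ : ℕ) : ℝ) = 1 / (kδ : ℝ) := by
    have hk : (0 : ℝ) < kδ := by exact_mod_cast hkδ
    push_cast
    field_simp
  calc uniformProb m {U | ¬ IsApproxCount kη (N x) (countEstimate (Fstar q cM cF F M) x 0 kη kδ U)}
      ≤ _ := hsub
    _ ≤ uniformProb m {U | uOf q cM cF x kη kδ U ∈ BadM M q x kη kδ N N'} +
          uniformProb m {U | ∃ i < Q, (U.drop (i * ℓ)).take ℓ ∈ B i (U.take (i * ℓ)) (U.drop (i * ℓ + ℓ))} :=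
        uniformProb_union_le m _ _
    _ ≤ 1 / ((kδ + kδ : ℕ) : ℝ) + Q * (1 / (K : ℝ)) := add_le_add hU2 hU3
    _ ≤ 1 / ((kδ + kδ : ℕ) : ℝ) + 1 / ((kδ + kδ : ℕ) : ℝ) := by linarith
    _ = 1 / (kδ : ℝ) := hhalf

end Transfer

end APTransfer

/-- **Dyer–Goldberg–Greenhill–Jerrum: an AP-reduction and an FPRAS for the target give an FPRAS for
the source** (`N ≤_AP N'`, `HasFPRAS N'` ⟹ `HasFPRAS N`), for the tree's transcript-model `APReducible`
and confidence-parameter `HasFPRAS` (`FPRAS.lean`). See `APTransfer.hasFPRAS_of_apReducible` for the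
proof. [cite: DyerEtAl2003, §1 (AP-reductions: "if … g has an FPRAS then so does f")] -/
theorem HasFPRAS.of_apReducible {N N' : List Bool → ℕ} (hred : APReducible N N') (hF : HasFPRAS N') :
    HasFPRAS N :=
  APTransfer.hasFPRAS_of_apReducible hred hF

/-- `HasFPRAS` is closed downwards under `≤_AP` (contrapositive form used by hardness transfers:
no FPRAS for `N` and `N ≤_AP N'` give no FPRAS for `N'`). [cite: DyerEtAl2003, §1] -/
theorem APReducible.not_hasFPRAS {N N' : List Bool → ℕ} (hred : APReducible N N') (hN : ¬ HasFPRAS N) :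
    ¬ HasFPRAS N' :=
  fun hN' => hN (HasFPRAS.of_apReducible hred hN')

/-- **An FPRAS pulls back along a count-preserving polynomial-time map**: if `g ∈ FP` and
`N x = N' (g x)` for all `x` (a parsimonious reduction), an FPRAS for `N'` gives one for `N` — run it
on `g x` with the same accuracy and confidence, on a prefix of the coins (a uniform prefix is
uniform; the output-length bound `exists_poly_length_le_of_mem_FP` of `CountingHierarchyProofs.lean`
sizes the coin budget). The special case of `HasFPRAS.of_apReducible` for one exact query, proved directly as an
`FP` composition. [cite: DyerEtAl2003, §1 (AP-reductions generalise parsimonious reductions)] -/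
theorem HasFPRAS.comp_countPreserving {N N' : List Bool → ℕ} (h : HasFPRAS N') {g : List Bool → List Bool}
    (hg : g ∈ FP) (hN : ∀ x, N x = N' (g x)) : HasFPRAS N := by
  obtain ⟨F, hF, c, hc⟩ := h
  obtain ⟨s, hs⟩ := exists_poly_length_le_of_mem_FP hg
  refine ⟨F ∘ APTransfer.pbF g c, comp_mem_FP hF (APTransfer.pbF_mem_FP hg c), c.comp (s + X),
    fun x kη kδ hkη hkδ => ?_⟩
  have hle : c.eval ((g x).length + kη + kδ) ≤ (c.comp (s + X)).eval (x.length + kη + kδ) := by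
    simp only [eval_comp, eval_add, eval_X]
    have h1 := hs x
    have h2 := TM2Iter.eval_mono s (show x.length ≤ x.length + kη + kδ by omega)
    exact TM2Iter.eval_mono c (by omega)
  have hset : {u | ¬ IsApproxCount kη (N x) (countEstimate (F ∘ APTransfer.pbF g c) x 0 kη kδ u)} =
      {u | u.take (c.eval ((g x).length + kη + kδ)) ∈
        {v | ¬ IsApproxCount kη (N' (g x)) (countEstimate F (g x) 0 kη kδ v)}} := by
    ext u
    simp only [Set.mem_setOf_eq, countEstimate_def, Function.comp_apply, APTransfer.pbF_W, hN]
  rw [hset]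
  exact APTransfer.uniformProb_take_le_of_le hle _ (hc (g x) kη kδ hkη hkδ)

/-- **`HasFPRAS` is stable under polynomial-time substitution**: `HasFPRAS N' → HasFPRAS (N' ∘ g)` for
`g ∈ FP`. [cite: DyerEtAl2003, §1] -/
theorem HasFPRAS.comp {N' : List Bool → ℕ} (h : HasFPRAS N') {g : List Bool → List Bool} (hg : g ∈ FP) :
    HasFPRAS (N' ∘ g) :=
  h.comp_countPreserving hg fun _ => rfl

end Literature.Computability.Complexity

end
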